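import Summits.BirchSwinnertonDyer.Rank1Residual.Additive.PadicBallLog
import Mathlib.Analysis.Normed.Unbundled.SpectralNorm
import HarnessLib

/-!
# K-PORT glue (G1): Galois / base-change EQUIVARIANCE of the parameter `z`, of the kernel of
# reduction `E₁(K)` and of the logarithm `Λ = log_E ∘ z` over complete ultrametric `ℚ_p`-fields
# (cell `bsd-addord`, seat w2-kport gen 0; `--supports stmt-BirchSwinnertonDyer-19560`)

HONEST FRAMING. Route W2 (`route-BirchSwinnertonDyer-KimAtThreeKolyvagin`), crux 19560
`KatoKuriharaPortThreeShared`, residual ⟨C1⟩ clause (C1.c) = LEMMA SAT₀'s E-side over the unramified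
completions `K_w ⊇ ℚ₃` (kim3 memos KIM3-W2-C1-g11 §2.4, KIM3-W2-C1-SIZING-g12 §1, brief
KIM3-KPORT-BRIEF-g12 §3 (E-K1): "a `Gal(K/ℚ₃)`-equivariant homomorphism `log_ω : E₀(K) → K`").
The x1b local series (`Rank1Residual/Additive/PadicBallSeriesEval … PadicBallLog`, namespace `BallEval`)
already supplies, for EVERY complete ultrametric normed `ℚ_p`-algebra `K` and every `M/ℤ_p` with
elliptic generic fibre, the curve `E = BallEval.curveK p K M = M ⊗ K`, its kernel of reduction
`E₁(K) = FormalGroupChart.kernel`, the parameter `z = WeierstrassCurve.Affine.Point.zCoord` and the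
logarithm `Λ = BallEval.ptLog p K M = log_E ∘ z`, additive on `E₁(K)` (`BallEval.ptLog_add`). This
file adds the EQUIVARIANCE that series does not state (inventory HOME/kport/KPORT-INVENTORY-g0.md (G1)).
TOOL theorems only (no definition, no named fact, no `sorry`); closes nothing by itself; nothing booked.

## What is proved

For two complete ultrametric normed `ℚ_p`-fields `K, K'`, a `ℚ_p`-algebra map `φ : K →ₐ[ℚ_[p]] K'`
which is an ISOMETRY (`hφ : ∀ x, ‖φ x‖ = ‖x‖`; automatic for `K = K'` algebraic over `ℚ_p`, §4) and
the induced homomorphism of Mordell–Weil groups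
`T_φ = WeierstrassCurve.Affine.Point.map φ : E(K) →+ E(K')` (Mathlib; note `BallEval.curveK p K M` is
DEFINITIONALLY `(M.map PadicInt.Coe.ringHom).baseChange K`, §2):

* §1 `qEval_map`: `f(φ u) = φ (f u)` for a `ℚ_p`-series `f` with `‖fₙ‖ ≤ n` and `‖u‖ < 1`;
  `bLog_map`: `log_E (φ t) = φ (log_E t)`.
* §2 `curveK_eq_baseChange` (`rfl`); `zCoord_map`: `z(T_φ P) = φ (z P)`; `map_mem_kernel_iff`:
  `T_φ P ∈ E₁(K') ↔ P ∈ E₁(K)`; `norm_zCoord_map`.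
* §3 **`ptLog_map`: `Λ(T_φ P) = φ (Λ P)` on `E₁(K)`** — the Galois equivariance of `log_ω`
  (for `σ ∈ Gal(K/ℚ_p)`, `Λ(σ P) = σ Λ(P)`), and `sum_map_mem_kernel`, `ptLog_sum_map` for a finite
  family of conjugates (`Λ(∑ᵢ φᵢ P) = ∑ᵢ φᵢ Λ(P)`).
* §4 `norm_algEquiv_eq`: every `σ : K ≃ₐ[ℚ_[p]] K` of an ALGEBRAIC `K/ℚ_p` is an isometry (Mathlib's
  uniqueness of the spectral norm), so the hypothesis `hφ` is discharged for Galois automorphisms: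
  `ptLog_galois`.

References: J. H. Silverman, *The Arithmetic of Elliptic Curves*, 2nd ed. (2009), IV.5–IV.6,
Prop. VII.2.2 [SilvermanAEC2009]; S. Bosch, U. Güntzer, R. Remmert, *Non-Archimedean Analysis* (1984)
3.2.4/2 (uniqueness of the spectral norm); kim3 brief HOME/kim3/KIM3-KPORT-BRIEF-g12.md §2–§3.
-/

noncomputable section

-- the cell's Theorems namespace `Summit.BirchSwinnertonDyer.BirchSwinnertonDyer.…` repeats the summit name by design (D-0017)
set_option linter.dupNamespace false

open scoped Classical
open PowerSeries

namespace Summit.BirchSwinnertonDyer.BirchSwinnertonDyer.Theorems.KPort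

open Summit.BirchSwinnertonDyer.Rank1Residual.Additive.BallEval
open Literature.NumberTheory.GaloisRepresentations.LubinTate (unitBall mem_unitBall_iff)
open Literature.NumberTheory.EllipticCurves Literature.NumberTheory.EllipticCurves.FormalGroupChart
open WeierstrassCurve

variable {p : ℕ} [hp : Fact p.Prime]

section Maps

variable {K : Type*} [NontriviallyNormedField K] [NormedAlgebra ℚ_[p] K]
  {K' : Type*} [NontriviallyNormedField K'] [NormedAlgebra ℚ_[p] K'] {M : WeierstrassCurve ℤ_[p]}

/-! ## §1 Isometric `ℚ_p`-algebra maps commute with the evaluation of `ℚ_p`-series -/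

/-- An isometric algebra map is continuous. [folklore] -/
theorem continuous_of_norm_map_eq (φ : K →ₐ[ℚ_[p]] K') (hφ : ∀ x, ‖φ x‖ = ‖x‖) : Continuous φ :=
  AddMonoidHomClass.continuous_of_bound φ 1 fun x => by rw [hφ, one_mul]

section Complete

variable [CompleteSpace K] [CompleteSpace K']

/-- **`f(φ u) = φ(f(u))`**: an isometric `ℚ_p`-algebra map commutes with the value of a `ℚ_p`-series of
logarithmic growth (`‖fₙ‖ ≤ n`) at a point of the open unit disc (`φ` is continuous and additive and
fixes the coefficients). [cite: SilvermanAEC2009, IV.6.3] -/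
theorem qEval_map (φ : K →ₐ[ℚ_[p]] K') (hφ : ∀ x, ‖φ x‖ = ‖x‖) {f : ℚ_[p]⟦X⟧}
    (hf : ∀ n, ‖coeff n f‖ ≤ n) {u : K} (hu : ‖u‖ < 1) :
    qEval p K' f (φ u) = φ (qEval p K f u) := by
  have h := (hasSum_qEval (K := K) hf hu).map φ (continuous_of_norm_map_eq φ hφ)
  have hu' : ‖φ u‖ < 1 := by rw [hφ]; exact hu
  have h' := hasSum_qEval (K := K') hf hu'
  have hfam : (fun n : ℕ => algebraMap ℚ_[p] K' (coeff n f) * φ u ^ n) =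
      (⇑φ ∘ fun n : ℕ => algebraMap ℚ_[p] K (coeff n f) * u ^ n) := by
    funext n
    simp only [Function.comp_apply, map_mul, map_pow, AlgHom.commutes]
  rw [hfam] at h'
  exact h'.unique h

/-- **`log_E(φ t) = φ(log_E t)`** for `‖t‖ < 1`. [cite: SilvermanAEC2009, IV.6.4] -/
theorem bLog_map (φ : K →ₐ[ℚ_[p]] K') (hφ : ∀ x, ‖φ x‖ = ‖x‖) {t : K} (ht : ‖t‖ < 1) :
    bLog p K' M (φ t) = φ (bLog p K M t) :=
  qEval_map φ hφ norm_coeff_logQ_le ht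

end Complete

/-! ## §2 The induced map on points: parameter and kernel of reduction -/

section Ultra

variable [IsUltrametricDist K] [IsUltrametricDist K']

/-- `BallEval.curveK p K M` IS Mathlib's base change `(M ⊗ ℚ_p) ⊗ K` (definitionally), so Mathlib's
`WeierstrassCurve.Affine.Point.map` / `baseChange` act on its points. [folklore] -/
theorem curveK_eq_baseChange : curveK p K M = (M.map PadicInt.Coe.ringHom).baseChange K := rfl

/-- **`z(T_φ P) = φ(z(P))`**: the parameter `z = -x/y` is equivariant. [cite: SilvermanAEC2009, Prop. VII.2.2] -/
theorem zCoord_map (φ : K →ₐ[ℚ_[p]] K') (P : (curveK p K M).toAffine.Point) :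
    Affine.Point.zCoord (W := (curveK p K' M).toAffine)
        (Affine.Point.map (W' := (M.map PadicInt.Coe.ringHom).toAffine) φ P) = φ P.zCoord := by
  rcases P with _ | ⟨x, y, h⟩
  · show (0 : K') = φ (0 : K)
    rw [map_zero]
  · show -(φ x) / φ y = φ (-x / y)
    rw [map_div₀, map_neg]

/-- `‖z(T_φ P)‖ = ‖z(P)‖` for an isometric `φ`. [folklore] -/
theorem norm_zCoord_map (φ : K →ₐ[ℚ_[p]] K') (hφ : ∀ x, ‖φ x‖ = ‖x‖)
    (P : (curveK p K M).toAffine.Point) :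
    ‖Affine.Point.zCoord (W := (curveK p K' M).toAffine)
        (Affine.Point.map (W' := (M.map PadicInt.Coe.ringHom).toAffine) φ P)‖ = ‖P.zCoord‖ := by
  rw [zCoord_map, hφ]

/-- **`T_φ P ∈ E₁(K') ↔ P ∈ E₁(K)`** for an isometric `φ` (membership is `‖x‖ > 1`).
[cite: SilvermanAEC2009, Prop. VII.2.2] -/
theorem map_mem_kernel_iff (φ : K →ₐ[ℚ_[p]] K') (hφ : ∀ x, ‖φ x‖ = ‖x‖)
    [(curveK p K M).IsIntegral (NormedField.valuation (K := K)).integer]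
    [(curveK p K' M).IsIntegral (NormedField.valuation (K := K')).integer]
    (P : (curveK p K M).toAffine.Point) :
    Affine.Point.map (W' := (M.map PadicInt.Coe.ringHom).toAffine) φ P ∈
        kernel (NormedField.valuation (K := K')) (curveK p K' M) ↔
      P ∈ kernel (NormedField.valuation (K := K)) (curveK p K M) := by
  rcases P with _ | ⟨x, y, h⟩
  · exact ⟨fun _ => (kernel (NormedField.valuation (K := K)) (curveK p K M)).zero_mem,
      fun _ => (kernel (NormedField.valuation (K := K')) (curveK p K' M)).zero_mem⟩
  · change Affine.Point.some (φ x) (φ y) _ ∈ kernel (NormedField.valuation (K := K')) (curveK p K' M) ↔ _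
    rw [some_mem_kernel_iff, some_mem_kernel_iff, ← NNReal.coe_lt_coe, ← NNReal.coe_lt_coe,
      NormedField.valuation_apply, NormedField.valuation_apply, coe_nnnorm, coe_nnnorm, hφ]

/-! ## §3 Equivariance of the logarithm `Λ = log_E ∘ z` -/

variable [CompleteSpace K] [CompleteSpace K']

/-- **Equivariance of the logarithm: `Λ(T_φ P) = φ(Λ(P))` on `E₁(K)`** for an isometric
`ℚ_p`-algebra map `φ : K → K'` — in particular `Λ(σP) = σ Λ(P)` for `σ ∈ Gal(K/ℚ_p)` (the
`Gal(K/ℚ₃)`-equivariance of `log_ω` in (E-K1) of kim3's SAT₀). [cite: SilvermanAEC2009, IV.6.4 and Prop. VII.2.2] -/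
theorem ptLog_map (φ : K →ₐ[ℚ_[p]] K') (hφ : ∀ x, ‖φ x‖ = ‖x‖)
    [(curveK p K M).IsIntegral (NormedField.valuation (K := K)).integer]
    {P : (curveK p K M).toAffine.Point}
    (hP : P ∈ kernel (NormedField.valuation (K := K)) (curveK p K M)) :
    ptLog p K' M (Affine.Point.map (W' := (M.map PadicInt.Coe.ringHom).toAffine) φ P) =
      φ (ptLog p K M P) := by
  rw [ptLog, ptLog, zCoord_map, bLog_map φ hφ (norm_zCoord_lt_one hP)]

omit [CompleteSpace K] [CompleteSpace K'] in
/-- A finite sum of conjugates of a point of `E₁(K)` lies in `E₁(K')`. [folklore] -/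
theorem sum_map_mem_kernel {ι : Type*} (s : Finset ι) (φ : ι → (K →ₐ[ℚ_[p]] K'))
    (hφ : ∀ i x, ‖φ i x‖ = ‖x‖)
    [(curveK p K M).IsIntegral (NormedField.valuation (K := K)).integer]
    [(curveK p K' M).IsIntegral (NormedField.valuation (K := K')).integer]
    {P : (curveK p K M).toAffine.Point}
    (hP : P ∈ kernel (NormedField.valuation (K := K)) (curveK p K M)) :
    (∑ i ∈ s, Affine.Point.map (W' := (M.map PadicInt.Coe.ringHom).toAffine) (φ i) P) ∈
      kernel (NormedField.valuation (K := K')) (curveK p K' M) := by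
  induction s using Finset.induction_on with
  | empty =>
    rw [Finset.sum_empty]
    exact (kernel (NormedField.valuation (K := K')) (curveK p K' M)).zero_mem
  | insert i s hi ih =>
    rw [Finset.sum_insert hi]
    exact (kernel (NormedField.valuation (K := K')) (curveK p K' M)).add_mem
      ((map_mem_kernel_iff (φ i) (hφ i) P).mpr hP) ih

/-- Equivariance for a finite sum of conjugates: `Λ(∑ᵢ T_{φᵢ} P) = ∑ᵢ φᵢ (Λ P)` for `P ∈ E₁(K)` and a
finite family of isometric `ℚ_p`-algebra maps `φᵢ : K → K'` (the shape of `Λ(N_{K/ℚ₃} P) = Tr(Λ P)`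
for the norm map of points). [cite: SilvermanAEC2009, IV.6.4] -/
theorem ptLog_sum_map {ι : Type*} (s : Finset ι) (φ : ι → (K →ₐ[ℚ_[p]] K'))
    (hφ : ∀ i x, ‖φ i x‖ = ‖x‖)
    [(curveK p K M).IsIntegral (NormedField.valuation (K := K)).integer]
    [(M.map PadicInt.Coe.ringHom).IsElliptic]
    [(curveK p K' M).IsIntegral (NormedField.valuation (K := K')).integer]
    {P : (curveK p K M).toAffine.Point}
    (hP : P ∈ kernel (NormedField.valuation (K := K)) (curveK p K M)) :
    ptLog p K' M (∑ i ∈ s, Affine.Point.map (W' := (M.map PadicInt.Coe.ringHom).toAffine) (φ i) P) =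
      ∑ i ∈ s, φ i (ptLog p K M P) := by
  induction s using Finset.induction_on with
  | empty => rw [Finset.sum_empty, Finset.sum_empty, ptLog_zero]
  | insert i s hi ih =>
    rw [Finset.sum_insert hi, Finset.sum_insert hi, ← ih, ← ptLog_map (φ i) (hφ i) hP]
    exact ptLog_add ((map_mem_kernel_iff (φ i) (hφ i) P).mpr hP) (sum_map_mem_kernel s φ hφ hP)

end Ultra

end Maps

/-! ## §4 Galois automorphisms of an algebraic `K/ℚ_p` are isometries -/

section Galois

variable {K : Type*} [NontriviallyNormedField K] [NormedAlgebra ℚ_[p] K] {M : WeierstrassCurve ℤ_[p]}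

/-- **Every `ℚ_p`-algebra automorphism of an algebraic extension `K/ℚ_p` with a field norm extending
`|·|_p` is an isometry** (both `‖·‖` and `‖σ ·‖` are absolute values extending `|·|_p`, hence equal
to the spectral norm: Mathlib `spectralNorm_unique_field_norm_ext`).
[Bosch–Güntzer–Remmert 3.2.4/2] [folklore] -/
theorem norm_algEquiv_eq [Algebra.IsAlgebraic ℚ_[p] K] (σ : K ≃ₐ[ℚ_[p]] K) (x : K) :
    ‖σ x‖ = ‖x‖ := by
  have hext : ∀ q : ℚ_[p], (NormedField.toAbsoluteValue K) (algebraMap ℚ_[p] K q) = ‖q‖ :=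
    fun q => norm_algebraMap' K q
  let f : AbsoluteValue K ℝ :=
    { toFun := fun y => ‖σ y‖
      map_mul' := fun a b => by simp only [map_mul, norm_mul]
      nonneg' := fun a => norm_nonneg _
      eq_zero' := fun a => by simp only [norm_eq_zero, EmbeddingLike.map_eq_zero_iff]
      add_le' := fun a b => by simp only [map_add]; exact norm_add_le _ _ }
  have hfext : ∀ q : ℚ_[p], f (algebraMap ℚ_[p] K q) = ‖q‖ := fun q => by
    show ‖σ (algebraMap ℚ_[p] K q)‖ = ‖q‖
    rw [AlgEquiv.commutes, norm_algebraMap']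
  have h1 := spectralNorm_unique_field_norm_ext hfext x
  have h2 := spectralNorm_unique_field_norm_ext hext x
  change ‖σ x‖ = spectralNorm ℚ_[p] K x at h1
  change ‖x‖ = spectralNorm ℚ_[p] K x at h2
  rw [h1, h2]

variable [IsUltrametricDist K] [CompleteSpace K]

/-- **`Λ(σ P) = σ Λ(P)` for every `σ ∈ Gal(K/ℚ_p)`**, `K/ℚ_p` algebraic (e.g. finite), `P ∈ E₁(K)`.
[cite: SilvermanAEC2009, IV.6.4 and Prop. VII.2.2] -/
theorem ptLog_galois [Algebra.IsAlgebraic ℚ_[p] K]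
    [(curveK p K M).IsIntegral (NormedField.valuation (K := K)).integer] (σ : K ≃ₐ[ℚ_[p]] K)
    {P : (curveK p K M).toAffine.Point}
    (hP : P ∈ kernel (NormedField.valuation (K := K)) (curveK p K M)) :
    ptLog p K M (Affine.Point.map (W' := (M.map PadicInt.Coe.ringHom).toAffine)
        (σ : K →ₐ[ℚ_[p]] K) P) = σ (ptLog p K M P) :=
  ptLog_map (σ : K →ₐ[ℚ_[p]] K) (norm_algEquiv_eq σ) hP

omit [CompleteSpace K] in
/-- `σ P ∈ E₁(K) ↔ P ∈ E₁(K)` for `σ ∈ Gal(K/ℚ_p)`, `K/ℚ_p` algebraic. [folklore] -/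
theorem galois_mem_kernel_iff [Algebra.IsAlgebraic ℚ_[p] K]
    [(curveK p K M).IsIntegral (NormedField.valuation (K := K)).integer] (σ : K ≃ₐ[ℚ_[p]] K)
    (P : (curveK p K M).toAffine.Point) :
    Affine.Point.map (W' := (M.map PadicInt.Coe.ringHom).toAffine) (σ : K →ₐ[ℚ_[p]] K) P ∈
        kernel (NormedField.valuation (K := K)) (curveK p K M) ↔
      P ∈ kernel (NormedField.valuation (K := K)) (curveK p K M) :=
  map_mem_kernel_iff (σ : K →ₐ[ℚ_[p]] K) (norm_algEquiv_eq σ) P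

end Galois

end Summit.BirchSwinnertonDyer.BirchSwinnertonDyer.Theorems.KPort

end
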